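import Summits.QuantumFields.YangMills.Theorems.UnitScaleTiltProp7LineAvgSmoothNormal
import Summits.QuantumFields.YangMills.Theorems.UnitScaleTiltProp7OneStrokeSplit
import Literature.MathematicalPhysics.QuantumFieldTheory.Balaban1983to89.B5Prop11FlatSliceCurlCoercivity
import HarnessLib

/-!
# Route `UnitScaleTilt`, crux K1 «MinimiserStabilityRegPr» (stmt-QuantumFields-19200), EX row `hGF` (curved member), the LOD line (★p1 g24 `LOCATE-L6-ASSEMBLY` §1 Step I.1,
# v1.1 «CUTOFFS»; w5 g13 spec (χ3)∕(χ4-coarse)) — **PEN (L6-χ), FILE C: THE BLOCK SPLIT `χ = χ̄∘blk + δ` OF A FINE-LIPSCHITZ CUTOFF — PATH TELESCOPING ON THE BLOCK LATTICE.**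

Cell `ym3-torus` (HUMAN RULING D-0037: YM₃ on T³ is ladder rung R3 — NOT d = 4, NOT infinite volume, NOT a mass gap, NOT Clay).  Width seat `ym3-torus-px17` (gen 8);
memo `LOCATE-L6chi-px17g8.md` (19200 evidence); FILE A ✓`…Prop7LODCutoffRealFamily`, FILE B ✓∕⧗`…Prop7LODCutoffLetters` (`exists_sqPartition`).  THEOREMS ONLY
(0 `def`, 0 `sorry`); `--supports stmt-QuantumFields-19200 --as helper`, count-neutral.  HONEST LABEL (№33 (6)): lattice-path bookkeeping for the perturbed block
edition ✓`Prop7IMSDoubleCommutatorPerturbedBlock` (w5 g13: `h b i = g b (blk i) + δ b i`, `|δ b i| ≤ ε`, `Σ_b δ_b i² ≤ ε²`, coarse Lipschitz rows of `g`); no estimate of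
Bałaban's; nothing of (L5x), (L6), `hGF`, `h349`, EX or the crux is proved here.

THE MATHEMATICS (generic torus `P : Params`, fine sites `Site P 0`, blocks of side `L^k`).  Write `corner Y := Site.fibreSite 0 k Y 0` (lowest label of the block
`B^k(Y)`), `g(Y) := f(corner Y)` (block-constant part) and `δ(x) := f(x) − f(corner (blk x))` (in-block oscillation).  If `|f(x + e_μ) − f(x)| ≤ a` for every fine step:
* along `t` steps in one direction `|f(x + t·e_μ) − f(x)| ≤ a·t` (`abs_sub_iterate_shift_le`), and for a FAMILY with `Σ_c (f_c(x + e_μ) − f_c x)² ≤ B` per step,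
  `Σ_c (f_c(x + t·e_μ) − f_c x)² ≤ t²·B` (`sum_sq_sub_iterate_shift_le`, Minkowski step by step);
* inside a block: the site of fibre offset `r` is reached from the corner by `Σ_ν r_ν ≤ d(L^k − 1)` unit steps that stay in the block
  (✓`Prop7LineAvgSmoothRightInverse.fibreSite_shift_of_lt`), so `|δ(x)| ≤ a·d(L^k − 1)` (`abs_sub_corner_le`) and `Σ_c δ_c(x)² ≤ (d(L^k − 1))²·B` (`sum_sq_sub_corner_le`);
* corners of adjacent blocks are `L^k` fine steps apart (✓`Prop7OneStrokeSplit.fibreSite_iterate_shift`), so the block-constant part is COARSE-Lipschitz: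
  `|g(Y + e_μ) − g(Y)| ≤ a·L^k`, `Σ_c (g_c(Y + e_μ) − g_c Y)² ≤ (L^k)²·B` (`abs_corner_shift_sub_le`, `sum_sq_corner_shift_sub_le`).
At the member (`k = K − n`, FILE B's `a = 27√2∕(L^s L^{K−n})`, `B = 2880∕(L^s L^{K−n})²`, `d = 3`, `η·L^{K−n} = 1`): `ε = 81√2∕L^s`, `Σ_cδ_c² ≤ 25920∕L^{2s}`,
coarse steps `27√2∕L^s` and `2880∕L^{2s}` — all K-FREE (the arithmetic is the assembler's one `nlinarith`; the rows here carry `a`, `B`, `L^k` as letters).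

References: T. Bałaban, CMP **99** (1985) 389–434 [Balaban1985BackgroundPropagators] ((3.100) pp.413–414, smooth partitions of the block lattice); CMP **95** (1984) 17–40
[Balaban1984PropagatorsI] ((1.6) p.18, (1.18) p.20: blocks and fibre labels); B. Simon, Ann. IHP A **38** (1983) 295–308 (IMS).
-/

set_option autoImplicit false

noncomputable section

open scoped BigOperators

namespace Summit.QuantumFields.YangMills.Theorems.Prop7LODCutoffBlockSplit

open Literature.MathematicalPhysics.QuantumFieldTheory.Balaban1983to89
open Finset LatticeFieldCalculus B1RG242Torus B5Eq118OneStroke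
open B10StarCount (shift_apply_self shift_apply_ne)
open B5Prop11FlatSliceCurlCoercivity (iterBlockOf_eq_proj)
open Summit.QuantumFields.YangMills.Theorems.Prop7LineAvgSmoothRightInverse (fibreSite_shift_of_lt eq_fibreSite_proj)
open Summit.QuantumFields.YangMills.Theorems.Prop7OneStrokeSplit (fibreSite_iterate_shift)

variable {P : Params} {k : ℕ}

/-! ## §1 Telescoping along one direction -/

/-- `|f(x + t·e_μ) − f(x)| ≤ a·t` from the per-step bound. [folklore] -/
theorem abs_sub_iterate_shift_le (f : Site P 0 → ℝ) {a : ℝ} (hf : ∀ (x : Site P 0) (μ : Fin P.d), |f (x.shift μ) - f x| ≤ a)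
    (x : Site P 0) (μ : Fin P.d) (t : ℕ) :
    |f ((fun z : Site P 0 => z.shift μ)^[t] x) - f x| ≤ a * t := by
  induction t with
  | zero => simp
  | succ t ih =>
    rw [Function.iterate_succ_apply', Nat.cast_succ]
    have h1 := hf ((fun z : Site P 0 => z.shift μ)^[t] x) μ
    have := abs_sub_le (f (((fun z : Site P 0 => z.shift μ)^[t] x).shift μ)) (f ((fun z : Site P 0 => z.shift μ)^[t] x)) (f x)
    linarith

/-- Minkowski, one step: `Σ(u+v)² ≤ (t+1)²B` if `Σu² ≤ t²B`, `Σv² ≤ B`. [folklore] -/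
theorem sum_sq_add_le_of_sq {ι : Type*} (s : Finset ι) (u v : ι → ℝ) {B t : ℝ} (ht : 0 ≤ t) (hB : 0 ≤ B)
    (hu : ∑ c ∈ s, u c ^ 2 ≤ t ^ 2 * B) (hv : ∑ c ∈ s, v c ^ 2 ≤ B) :
    ∑ c ∈ s, (u c + v c) ^ 2 ≤ (t + 1) ^ 2 * B := by
  have hcs : (∑ c ∈ s, u c * v c) ^ 2 ≤ (∑ c ∈ s, u c ^ 2) * ∑ c ∈ s, v c ^ 2 := Finset.sum_mul_sq_le_sq_mul_sq s u v
  have hU0 : 0 ≤ ∑ c ∈ s, u c ^ 2 := Finset.sum_nonneg fun _ _ => sq_nonneg _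
  have hV0 : 0 ≤ ∑ c ∈ s, v c ^ 2 := Finset.sum_nonneg fun _ _ => sq_nonneg _
  have hprod : (∑ c ∈ s, u c * v c) ^ 2 ≤ (t * B) ^ 2 := by
    refine hcs.trans ?_
    calc (∑ c ∈ s, u c ^ 2) * ∑ c ∈ s, v c ^ 2 ≤ (t ^ 2 * B) * B := mul_le_mul hu hv hV0 (by positivity)
      _ = (t * B) ^ 2 := by ring
  have hcross : ∑ c ∈ s, u c * v c ≤ t * B := by
    by_contra hlt
    have hlt' : t * B < ∑ c ∈ s, u c * v c := lt_of_not_ge hlt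
    have h0 : 0 ≤ t * B := by positivity
    have : (t * B) ^ 2 < (∑ c ∈ s, u c * v c) ^ 2 := by nlinarith
    linarith
  have hexp : ∑ c ∈ s, (u c + v c) ^ 2 = ∑ c ∈ s, u c ^ 2 + 2 * ∑ c ∈ s, u c * v c + ∑ c ∈ s, v c ^ 2 := by
    rw [Finset.mul_sum, ← Finset.sum_add_distrib, ← Finset.sum_add_distrib]
    exact Finset.sum_congr rfl fun c _ => by ring
  have hsq : (t + 1) ^ 2 * B = t ^ 2 * B + 2 * (t * B) + B := by ring
  rw [hexp, hsq]
  linarith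

/-- Family version: `Σ_c (f_c(x + t·e_μ) − f_c x)² ≤ t²·B` from the per-step family bound `B`. [folklore] -/
theorem sum_sq_sub_iterate_shift_le {ι : Type*} (s : Finset ι) (f : ι → Site P 0 → ℝ) {B : ℝ} (hB : 0 ≤ B)
    (hf : ∀ (x : Site P 0) (μ : Fin P.d), ∑ c ∈ s, (f c (x.shift μ) - f c x) ^ 2 ≤ B) (x : Site P 0) (μ : Fin P.d) (t : ℕ) :
    ∑ c ∈ s, (f c ((fun z : Site P 0 => z.shift μ)^[t] x) - f c x) ^ 2 ≤ (t : ℝ) ^ 2 * B := by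
  induction t with
  | zero => simp
  | succ t ih =>
    have hsplit : ∀ c ∈ s, f c ((fun z : Site P 0 => z.shift μ)^[t + 1] x) - f c x
        = (f c ((fun z : Site P 0 => z.shift μ)^[t] x) - f c x) + (f c (((fun z : Site P 0 => z.shift μ)^[t] x).shift μ) - f c ((fun z : Site P 0 => z.shift μ)^[t] x)) := by
      intro c _; rw [Function.iterate_succ_apply']; ring
    rw [Finset.sum_congr rfl fun c hc => by rw [hsplit c hc], Nat.cast_succ]
    exact sum_sq_add_le_of_sq s _ _ (Nat.cast_nonneg t) hB ih (hf _ μ)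

/-! ## §2 Telescoping from the block corner -/

/-- the sum of fibre offsets after lowering one positive coordinate by one. [folklore] -/
theorem sum_val_update_pred (r : Fin P.d → Fin (P.L ^ k)) (ν : Fin P.d) (hν : 0 < (r ν : ℕ)) (h1 : (r ν : ℕ) - 1 < P.L ^ k) :
    ∑ μ, ((Function.update r ν ⟨(r ν : ℕ) - 1, h1⟩ μ : Fin (P.L ^ k)) : ℕ) + 1 = ∑ μ, (r μ : ℕ) := by
  have hsplit : ∀ g : Fin P.d → ℕ, ∑ μ, g μ = g ν + ∑ μ ∈ Finset.univ.erase ν, g μ := fun g =>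
    (Finset.add_sum_erase Finset.univ g (Finset.mem_univ ν)).symm
  rw [hsplit (fun μ => ((Function.update r ν ⟨(r ν : ℕ) - 1, h1⟩ μ : Fin (P.L ^ k)) : ℕ)), hsplit (fun μ => (r μ : ℕ))]
  simp only [Function.update_self]
  have hrest : ∑ μ ∈ Finset.univ.erase ν, ((Function.update r ν ⟨(r ν : ℕ) - 1, h1⟩ μ : Fin (P.L ^ k)) : ℕ) = ∑ μ ∈ Finset.univ.erase ν, (r μ : ℕ) :=
    Finset.sum_congr rfl fun μ hμ => by rw [Function.update_of_ne (Finset.ne_of_mem_erase hμ)]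
  rw [hrest]
  omega

/-- ★ **IN-BLOCK OSCILLATION FROM THE CORNER**: `|f(x_r) − f(x_0)| ≤ a·Σ_ν r_ν` for the fibre site `x_r` of offset `r` in the block `B^k(y)` (unit steps inside the block).
[cite: Balaban1984PropagatorsI, (1.18) p.20] -/
theorem abs_sub_fibreSite_zero_le (f : Site P 0 → ℝ) {a : ℝ} (hf : ∀ (x : Site P 0) (μ : Fin P.d), |f (x.shift μ) - f x| ≤ a)
    (y : Site P k) (h0 : 0 < P.L ^ k) :
    ∀ (N : ℕ) (r : Fin P.d → Fin (P.L ^ k)), ∑ ν, (r ν : ℕ) = N →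
      |f (Site.fibreSite 0 k y r) - f (Site.fibreSite 0 k y fun _ => ⟨0, h0⟩)| ≤ a * N := by
  intro N
  induction N with
  | zero =>
    intro r hr
    have hr0 : r = fun _ => ⟨0, h0⟩ := by
      funext ν
      have : (r ν : ℕ) = 0 := by
        have := Finset.sum_eq_zero_iff.mp hr ν (Finset.mem_univ ν); exact this
      exact Fin.ext this
    rw [hr0, sub_self, abs_zero, Nat.cast_zero, mul_zero]
  | succ N ih =>
    intro r hr
    -- a positive coordinate
    obtain ⟨ν, hν⟩ : ∃ ν, 0 < (r ν : ℕ) := by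
      by_contra hcon
      simp only [not_exists, not_lt, Nat.le_zero] at hcon
      have : ∑ ν, (r ν : ℕ) = 0 := Finset.sum_eq_zero fun ν _ => hcon ν
      omega
    have h1 : (r ν : ℕ) - 1 < P.L ^ k := by have := (r ν).isLt; omega
    set r' : Fin P.d → Fin (P.L ^ k) := Function.update r ν ⟨(r ν : ℕ) - 1, h1⟩ with hr'
    have hsum' : ∑ μ, (r' μ : ℕ) = N := by
      have := sum_val_update_pred r ν hν h1; rw [← hr'] at this; omega
    have hr'ν : (r' ν : ℕ) + 1 < P.L ^ k := by
      rw [hr', Function.update_self]; have := (r ν).isLt; simp only; omega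
    have hback : Function.update r' ν ⟨(r' ν : ℕ) + 1, hr'ν⟩ = r := by
      funext μ'
      by_cases hμ : μ' = ν
      · subst hμ
        rw [Function.update_self]
        apply Fin.ext
        simp only [hr', Function.update_self]
        omega
      · rw [Function.update_of_ne hμ, hr', Function.update_of_ne hμ]
    have hstep : Site.fibreSite 0 k y r = (Site.fibreSite 0 k y r').shift ν := by
      rw [fibreSite_shift_of_lt y r' ν hr'ν, hback]
    have hih := ih r' hsum'
    have hone := hf (Site.fibreSite 0 k y r') ν
    rw [← hstep] at hone
    have htri := abs_sub_le (f (Site.fibreSite 0 k y r)) (f (Site.fibreSite 0 k y r')) (f (Site.fibreSite 0 k y fun _ => ⟨0, h0⟩))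
    rw [Nat.cast_succ]
    linarith

/-- Family version: `Σ_c (f_c(x_r) − f_c(x_0))² ≤ (Σ_ν r_ν)²·B`. [cite: Balaban1984PropagatorsI, (1.18) p.20] -/
theorem sum_sq_sub_fibreSite_zero_le {ι : Type*} (s : Finset ι) (f : ι → Site P 0 → ℝ) {B : ℝ} (hB : 0 ≤ B)
    (hf : ∀ (x : Site P 0) (μ : Fin P.d), ∑ c ∈ s, (f c (x.shift μ) - f c x) ^ 2 ≤ B) (y : Site P k) (h0 : 0 < P.L ^ k) :
    ∀ (N : ℕ) (r : Fin P.d → Fin (P.L ^ k)), ∑ ν, (r ν : ℕ) = N →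
      ∑ c ∈ s, (f c (Site.fibreSite 0 k y r) - f c (Site.fibreSite 0 k y fun _ => ⟨0, h0⟩)) ^ 2 ≤ (N : ℝ) ^ 2 * B := by
  intro N
  induction N with
  | zero =>
    intro r hr
    have hr0 : r = fun _ => ⟨0, h0⟩ := by
      funext ν
      have : (r ν : ℕ) = 0 := by
        have := Finset.sum_eq_zero_iff.mp hr ν (Finset.mem_univ ν); exact this
      exact Fin.ext this
    simp [hr0]
  | succ N ih =>
    intro r hr
    obtain ⟨ν, hν⟩ : ∃ ν, 0 < (r ν : ℕ) := by
      by_contra hcon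
      simp only [not_exists, not_lt, Nat.le_zero] at hcon
      have : ∑ ν, (r ν : ℕ) = 0 := Finset.sum_eq_zero fun ν _ => hcon ν
      omega
    have h1 : (r ν : ℕ) - 1 < P.L ^ k := by have := (r ν).isLt; omega
    set r' : Fin P.d → Fin (P.L ^ k) := Function.update r ν ⟨(r ν : ℕ) - 1, h1⟩ with hr'
    have hsum' : ∑ μ, (r' μ : ℕ) = N := by
      have := sum_val_update_pred r ν hν h1; rw [← hr'] at this; omega
    have hr'ν : (r' ν : ℕ) + 1 < P.L ^ k := by
      rw [hr', Function.update_self]; have := (r ν).isLt; simp only; omega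
    have hback : Function.update r' ν ⟨(r' ν : ℕ) + 1, hr'ν⟩ = r := by
      funext μ'
      by_cases hμ : μ' = ν
      · subst hμ
        rw [Function.update_self]
        apply Fin.ext
        simp only [hr', Function.update_self]
        omega
      · rw [Function.update_of_ne hμ, hr', Function.update_of_ne hμ]
    have hstep : Site.fibreSite 0 k y r = (Site.fibreSite 0 k y r').shift ν := by
      rw [fibreSite_shift_of_lt y r' ν hr'ν, hback]
    have hih := ih r' hsum'
    have hone := hf (Site.fibreSite 0 k y r') ν
    rw [← hstep] at hone
    have hsplit : ∀ c ∈ s, f c (Site.fibreSite 0 k y r) - f c (Site.fibreSite 0 k y fun _ => ⟨0, h0⟩)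
        = (f c (Site.fibreSite 0 k y r') - f c (Site.fibreSite 0 k y fun _ => ⟨0, h0⟩)) + (f c (Site.fibreSite 0 k y r) - f c (Site.fibreSite 0 k y r')) := by
      intro c _; ring
    rw [Finset.sum_congr rfl fun c hc => by rw [hsplit c hc], Nat.cast_succ]
    exact sum_sq_add_le_of_sq s _ _ (Nat.cast_nonneg N) hB hih hone

/-- the total fibre offset is at most `d·(L^k − 1)`. [folklore] -/
theorem sum_val_le (r : Fin P.d → Fin (P.L ^ k)) : ((∑ ν, (r ν : ℕ) : ℕ) : ℝ) ≤ (P.d : ℝ) * ((P.L : ℝ) ^ k - 1) := by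
  have h1 : ∑ ν, (r ν : ℕ) ≤ P.d * (P.L ^ k - 1) := by
    calc ∑ ν, (r ν : ℕ) ≤ ∑ _ν : Fin P.d, (P.L ^ k - 1) := Finset.sum_le_sum fun ν _ => by have := (r ν).isLt; omega
      _ = P.d * (P.L ^ k - 1) := by simp
  have hL : 1 ≤ P.L ^ k := Nat.one_le_pow _ _ P.L_pos
  have : ((∑ ν, (r ν : ℕ) : ℕ) : ℝ) ≤ ((P.d * (P.L ^ k - 1) : ℕ) : ℝ) := by exact_mod_cast h1
  rw [Nat.cast_mul, Nat.cast_sub hL, Nat.cast_pow, Nat.cast_one] at this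
  exact this

/-- ★★ **THE IN-BLOCK OSCILLATION ROW** (`ε` of the perturbed block edition): with `corner Y := Site.fibreSite 0 k Y 0`,
`|f(x) − f(corner (B^k x))| ≤ a·d·(L^k − 1)` for every fine site `x`. [cite: Balaban1984PropagatorsI, (1.6) p.18, (1.18) p.20; Balaban1985BackgroundPropagators, (3.100) pp.413-414] -/
theorem abs_sub_corner_le (hk : k ≤ P.m + P.K) (f : Site P 0 → ℝ) {a : ℝ} (hf : ∀ (x : Site P 0) (μ : Fin P.d), |f (x.shift μ) - f x| ≤ a)
    (x : Site P 0) :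
    |f x - f (Site.fibreSite 0 k (iterBlockOf k x) fun _ => ⟨0, pow_pos P.L_pos k⟩)| ≤ a * ((P.d : ℝ) * ((P.L : ℝ) ^ k - 1)) := by
  have h : P.sitesPerDir 0 = P.L ^ k * P.sitesPerDir k := by
    have := sitesPerDir_zero_eq P k; rwa [lvl_of_le P hk] at this
  have ha : 0 ≤ a := (abs_nonneg _).trans (hf x ⟨0, P.hd⟩)
  obtain ⟨r, hr⟩ := eq_fibreSite_proj h x
  rw [iterBlockOf_eq_proj hk x]
  have hmain := abs_sub_fibreSite_zero_le f hf (Site.proj k k x) (pow_pos P.L_pos k) _ r rfl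
  rw [← hr] at hmain
  exact hmain.trans (mul_le_mul_of_nonneg_left (sum_val_le r) ha)

/-- ★★ Family version: `Σ_c (f_c(x) − f_c(corner (B^k x)))² ≤ (d(L^k − 1))²·B`. [cite: Balaban1984PropagatorsI, (1.18) p.20; Balaban1985BackgroundPropagators, (3.100) pp.413-414] -/
theorem sum_sq_sub_corner_le (hk : k ≤ P.m + P.K) {ι : Type*} (s : Finset ι) (f : ι → Site P 0 → ℝ) {B : ℝ} (hB : 0 ≤ B)
    (hf : ∀ (x : Site P 0) (μ : Fin P.d), ∑ c ∈ s, (f c (x.shift μ) - f c x) ^ 2 ≤ B) (x : Site P 0) :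
    ∑ c ∈ s, (f c x - f c (Site.fibreSite 0 k (iterBlockOf k x) fun _ => ⟨0, pow_pos P.L_pos k⟩)) ^ 2 ≤ ((P.d : ℝ) * ((P.L : ℝ) ^ k - 1)) ^ 2 * B := by
  have h : P.sitesPerDir 0 = P.L ^ k * P.sitesPerDir k := by
    have := sitesPerDir_zero_eq P k; rwa [lvl_of_le P hk] at this
  obtain ⟨r, hr⟩ := eq_fibreSite_proj h x
  rw [iterBlockOf_eq_proj hk x]
  have hmain := sum_sq_sub_fibreSite_zero_le s f hB hf (Site.proj k k x) (pow_pos P.L_pos k) _ r rfl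
  rw [← hr] at hmain
  refine hmain.trans (mul_le_mul_of_nonneg_right ?_ hB)
  have h0 : (0 : ℝ) ≤ ∑ ν, (r ν : ℕ) := by positivity
  exact pow_le_pow_left₀ h0 (sum_val_le r) 2

/-! ## §3 The block-constant part is coarse-Lipschitz -/

/-- ★ **CORNERS OF ADJACENT BLOCKS ARE `L^k` FINE STEPS APART**: `|f(corner (Y + e_μ)) − f(corner Y)| ≤ a·L^k`. [cite: Balaban1984PropagatorsI, (1.18) p.20] -/
theorem abs_corner_shift_sub_le (hk : k ≤ P.m + P.K) (f : Site P 0 → ℝ) {a : ℝ} (hf : ∀ (x : Site P 0) (μ : Fin P.d), |f (x.shift μ) - f x| ≤ a)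
    (Y : Site P k) (μ : Fin P.d) :
    |f (Site.fibreSite 0 k (Y.shift μ) fun _ => ⟨0, pow_pos P.L_pos k⟩) - f (Site.fibreSite 0 k Y fun _ => ⟨0, pow_pos P.L_pos k⟩)| ≤ a * (P.L : ℝ) ^ k := by
  have h : P.sitesPerDir 0 = P.L ^ k * P.sitesPerDir k := by
    have := sitesPerDir_zero_eq P k; rwa [lvl_of_le P hk] at this
  have hit := fibreSite_iterate_shift h Y μ 1 (fun _ => ⟨0, pow_pos P.L_pos k⟩)
  rw [Function.iterate_one, one_mul] at hit
  rw [hit]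
  have := abs_sub_iterate_shift_le f hf (Site.fibreSite 0 k Y fun _ => ⟨0, pow_pos P.L_pos k⟩) μ (P.L ^ k)
  rwa [Nat.cast_pow] at this

/-- ★ Family version: `Σ_c (f_c(corner (Y + e_μ)) − f_c(corner Y))² ≤ (L^k)²·B`. [cite: Balaban1984PropagatorsI, (1.18) p.20] -/
theorem sum_sq_corner_shift_sub_le (hk : k ≤ P.m + P.K) {ι : Type*} (s : Finset ι) (f : ι → Site P 0 → ℝ) {B : ℝ} (hB : 0 ≤ B)
    (hf : ∀ (x : Site P 0) (μ : Fin P.d), ∑ c ∈ s, (f c (x.shift μ) - f c x) ^ 2 ≤ B) (Y : Site P k) (μ : Fin P.d) :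
    ∑ c ∈ s, (f c (Site.fibreSite 0 k (Y.shift μ) fun _ => ⟨0, pow_pos P.L_pos k⟩) - f c (Site.fibreSite 0 k Y fun _ => ⟨0, pow_pos P.L_pos k⟩)) ^ 2
      ≤ ((P.L : ℝ) ^ k) ^ 2 * B := by
  have h : P.sitesPerDir 0 = P.L ^ k * P.sitesPerDir k := by
    have := sitesPerDir_zero_eq P k; rwa [lvl_of_le P hk] at this
  have hit := fibreSite_iterate_shift h Y μ 1 (fun _ => ⟨0, pow_pos P.L_pos k⟩)
  rw [Function.iterate_one, one_mul] at hit
  rw [hit]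
  have := sum_sq_sub_iterate_shift_le s f hB hf (Site.fibreSite 0 k Y fun _ => ⟨0, pow_pos P.L_pos k⟩) μ (P.L ^ k)
  rwa [Nat.cast_pow] at this

end Summit.QuantumFields.YangMills.Theorems.Prop7LODCutoffBlockSplit

end
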